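import Mathlib.Tactic.Module
import Literature.NumberTheory.Transcendental.KZRelationsLE
import Literature.NumberTheory.Transcendental.KZSubcalculusInvariants

/-!
# Birth skeleton of the piece `LegendreMiddleTrace` (child of `DeltaRatioHecke`, route HeckeMultiplicityOne; crux-strategist 2026-08-17)

The `T₂` trace identity on `L*(Δ,5)`, `9[R₃] − 30[R₅] + 16[R₇] ∈ KZ.relations`, cut into the three
Hecke branches exactly as for `LegendreHeckeTrace`, now on the pattern-6 family (`R₅ = R(6)`, weight
`τ⁴ = (iB/A)⁴`): auxiliary representations on the cube `u = [8t³·∏]` (value `64·I₅`: `2¹¹·2⁻⁵`),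
`w = [8(1−t)³·∏]` (value `16·I₅`: `½·2⁵`), `c = [8·∏]` (value `104·I₅ = −36I₃ + 224I₅ − 64I₇`), `∏` the
pattern-6 product; all three value identities checked to 1e−15.
* `stub_landenDescending` — `[u] − 64·[R₅] ∈ relations`; `stub_landenAscending` — `[w] − 16·[R₅] ∈ relations`
  (Landen `τ ↦ 2τ, τ/2` with the weights `(B/A)⁴ ↦ 2^{±4}(B/A)⁴` carried by the factorwise substitution);
* `stub_cuspHalf` — `[c] + 36[R₃] − 224[R₅] + 64[R₇] ∈ relations` (Cauchy on `(0,1/2,i∞)` + `γ`-pullback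
  `(2τ+1)⁶`, `(2σ−1)⁴`; the hard stub);
* `stub_eigenIdentity` — `24[R₅] + [u] + [w] − [c] ∈ relations` (rule 1b, provable now);
* `stub_auxRepsExist` — `u, w, c` exist (provable now).
Composition: `ρ_cusp + ρ_eigen − ρ_desc − ρ_asc = 36[R₃] − 120[R₅] + 64[R₇] = 4·C2`, then integer
division by `4` (torsion-freeness, re-derived below from `KZ.scale`).

`lean check`: sorries ONLY in `stub_*`; the composition `LegendreMiddleTrace_of` is a real proof and concludes the
piece's text verbatim (the child item's statement once the split is applied).
Sources: Manin 1973 §§7–9; Kontsevich–Zagier 2001 §1.2, §3.4; Paşol–Popa arXiv:1202.5802 §5.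
-/

noncomputable section

namespace Summit.KontsevichZagierPeriods.KontsevichZagierPeriods.Cruxes.DeltaRatioHecke.MiddleTraceBirth

open Set MeasureTheory
open Literature.NumberTheory.Transcendental
open Literature.NumberTheory.Transcendental.KZ

/-! ### Torsion (re-derived; see the glue module) -/

section Torsion

variable {n : ℕ}

/-- The algebraic constant `1/k`. [folklore] -/
theorem isAlgebraic_inv_nat (k : ℕ) : IsAlgebraic ℚ ((k : ℝ)⁻¹) :=
  IsAlgebraic.inv_iff.mpr (isAlgebraic_nat k)

/-- Scaling by `k` after scaling by `1/k` gives back the representation (`k ≠ 0`). [folklore] -/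
theorem constMul_constMul_inv (r : IntegralRep n) {k : ℕ} (hk : k ≠ 0) :
    (r.constMul ((k : ℝ)⁻¹) (isAlgebraic_inv_nat k)).constMul (k : ℝ) (isAlgebraic_nat k) = r := by
  have hk' : (k : ℝ) ≠ 0 := Nat.cast_ne_zero.mpr hk
  rcases r with ⟨σ, f, h₁, h₂, h₃⟩
  simp only [IntegralRep.constMul, IntegralRep.mk.injEq, true_and]
  funext x
  rw [← mul_assoc, mul_inv_cancel₀ hk', one_mul]

/-- Generatorwise: `[σ, f] − k • [σ, f/k]` is a relation (integrand additivity,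
`KZ.IntegralRep.of_constMul_nat_sub_nsmul_mem_relations`). [cite: KontsevichZagier2001, §1.2 rule (1)] -/
theorem of_sub_nsmul_of_constMul_inv_mem_relations (r : IntegralRep n) {k : ℕ} (hk : k ≠ 0) :
    of r - k • of (r.constMul ((k : ℝ)⁻¹) (isAlgebraic_inv_nat k)) ∈ relations := by
  have h := IntegralRep.of_constMul_nat_sub_nsmul_mem_relations
    (r.constMul ((k : ℝ)⁻¹) (isAlgebraic_inv_nat k)) k
  rwa [constMul_constMul_inv r hk] at h

/-- Every formal combination `c` is congruent to `k • scale (1/k) c` modulo relations.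
[cite: KontsevichZagier2001, §1.2 rule (1)] -/
theorem sub_nsmul_scale_inv_mem_relations {k : ℕ} (hk : k ≠ 0) (c : FormalRep) :
    c - k • scale ((k : ℝ)⁻¹) (isAlgebraic_inv_nat k) c ∈ relations := by
  induction c using FreeAbelianGroup.induction_on with
  | zero => simp
  | of x =>
    obtain ⟨n, r⟩ := x
    change of r - k • scale ((k : ℝ)⁻¹) (isAlgebraic_inv_nat k) (of r) ∈ relations
    rw [scale_of]
    exact of_sub_nsmul_of_constMul_inv_mem_relations r hk
  | neg x hx =>
    obtain ⟨n, r⟩ := x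
    change -of r - k • scale ((k : ℝ)⁻¹) (isAlgebraic_inv_nat k) (-of r) ∈ relations
    have : -of r - k • scale ((k : ℝ)⁻¹) (isAlgebraic_inv_nat k) (-of r) =
        -(of r - k • scale ((k : ℝ)⁻¹) (isAlgebraic_inv_nat k) (of r)) := by
      rw [map_neg, smul_neg]; abel
    rw [this]
    exact relations.neg_mem hx
  | add x y hx hy =>
    have : x + y - k • scale ((k : ℝ)⁻¹) (isAlgebraic_inv_nat k) (x + y) =
        (x - k • scale ((k : ℝ)⁻¹) (isAlgebraic_inv_nat k) x) +
        (y - k • scale ((k : ℝ)⁻¹) (isAlgebraic_inv_nat k) y) := by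
      rw [map_add, smul_add]; abel
    rw [this]
    exact relations.add_mem hx hy

/-- **`FormalRep ⧸ relations` has no `k`-torsion** (`k ≠ 0` natural): `k • c ∈ relations → c ∈ relations`.
[cite: KontsevichZagier2001, §1.2] -/
theorem mem_relations_of_nsmul_mem {k : ℕ} (hk : k ≠ 0) {c : FormalRep}
    (h : k • c ∈ relations) : c ∈ relations := by
  have h1 := sub_nsmul_scale_inv_mem_relations hk c
  have h2 : k • scale ((k : ℝ)⁻¹) (isAlgebraic_inv_nat k) c ∈ relations := by
    rw [← map_nsmul]
    exact scale_mem_relations _ _ h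
  simpa using relations.add_mem h1 h2

/-- **Integer division is admissible**: `k ≠ 0`, `k • c ∈ relations → c ∈ relations` (`k : ℤ`).
[cite: KontsevichZagier2001, §1.2] -/
theorem mem_relations_of_zsmul_mem {k : ℤ} (hk : k ≠ 0) {c : FormalRep}
    (h : k • c ∈ relations) : c ∈ relations := by
  have hk0 : k.natAbs ≠ 0 := by simpa using hk
  rcases Int.natAbs_eq k with hk' | hk'
  · rw [hk', natCast_zsmul] at h
    exact mem_relations_of_nsmul_mem hk0 h
  · rw [hk', neg_smul, natCast_zsmul] at h
    exact mem_relations_of_nsmul_mem hk0 (relations.neg_mem_iff.mp h)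

end Torsion

/-- STUB: descending Landen on the pattern-6 family: `[8t³∏] − 64·[R₅] ∈ relations`. [cite: KontsevichZagier2001, §1.2 rule (2)] -/
theorem stub_landenDescending :
    ∀ (r₅ u : Literature.NumberTheory.Transcendental.KZ.IntegralRep 11), r₅.domain = {v | ∀ i, v i ∈ Set.Ioo (0:ℝ) 1} → Set.EqOn r₅.integrand (fun v => v 0 * (1 - v 0) * ∏ i : Fin 10, 1 / Real.sqrt (v i.succ * (1 - v i.succ) * (1 - (if (i : ℕ) < 6 then v 0 else 1 - v 0) * v i.succ))) r₅.domain → u.domain = {v | ∀ i, v i ∈ Set.Ioo (0:ℝ) 1} → Set.EqOn u.integrand (fun v => 8 * v 0 ^ 3 * ∏ i : Fin 10, 1 / Real.sqrt (v i.succ * (1 - v i.succ) * (1 - (if (i : ℕ) < 6 then v 0 else 1 - v 0) * v i.succ))) u.domain → Literature.NumberTheory.Transcendental.KZ.of u - (64 : ℤ) • Literature.NumberTheory.Transcendental.KZ.of r₅ ∈ Literature.NumberTheory.Transcendental.KZ.relations := by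
  sorry

/-- STUB: ascending Landen on the pattern-6 family: `[8(1−t)³∏] − 16·[R₅] ∈ relations`. [cite: KontsevichZagier2001, §1.2 rule (2)] -/
theorem stub_landenAscending :
    ∀ (r₅ w : Literature.NumberTheory.Transcendental.KZ.IntegralRep 11), r₅.domain = {v | ∀ i, v i ∈ Set.Ioo (0:ℝ) 1} → Set.EqOn r₅.integrand (fun v => v 0 * (1 - v 0) * ∏ i : Fin 10, 1 / Real.sqrt (v i.succ * (1 - v i.succ) * (1 - (if (i : ℕ) < 6 then v 0 else 1 - v 0) * v i.succ))) r₅.domain → w.domain = {v | ∀ i, v i ∈ Set.Ioo (0:ℝ) 1} → Set.EqOn w.integrand (fun v => 8 * (1 - v 0) ^ 3 * ∏ i : Fin 10, 1 / Real.sqrt (v i.succ * (1 - v i.succ) * (1 - (if (i : ℕ) < 6 then v 0 else 1 - v 0) * v i.succ))) w.domain → Literature.NumberTheory.Transcendental.KZ.of w - (16 : ℤ) • Literature.NumberTheory.Transcendental.KZ.of r₅ ∈ Literature.NumberTheory.Transcendental.KZ.relations := by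
  sorry

/-- STUB (hardest): the cusp `1/2` with weight `τ⁴`: `[8∏] + 36[R₃] − 224[R₅] + 64[R₇] ∈ relations`. [cite: Manin1973, §§7–9] -/
theorem stub_cuspHalf :
    ∀ (c r₃ r₅ r₇ : Literature.NumberTheory.Transcendental.KZ.IntegralRep 11), c.domain = {v | ∀ i, v i ∈ Set.Ioo (0:ℝ) 1} → Set.EqOn c.integrand (fun v => (8 : ℝ) * ∏ i : Fin 10, 1 / Real.sqrt (v i.succ * (1 - v i.succ) * (1 - (if (i : ℕ) < 6 then v 0 else 1 - v 0) * v i.succ))) c.domain → r₃.domain = {v | ∀ i, v i ∈ Set.Ioo (0:ℝ) 1} → Set.EqOn r₃.integrand (fun v => v 0 * (1 - v 0) * ∏ i : Fin 10, 1 / Real.sqrt (v i.succ * (1 - v i.succ) * (1 - (if (i : ℕ) < 8 then v 0 else 1 - v 0) * v i.succ))) r₃.domain → r₅.domain = {v | ∀ i, v i ∈ Set.Ioo (0:ℝ) 1} → Set.EqOn r₅.integrand (fun v => v 0 * (1 - v 0) * ∏ i : Fin 10, 1 / Real.sqrt (v i.succ * (1 - v i.succ) * (1 - (if (i : ℕ)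 < 6 then v 0 else 1 - v 0) * v i.succ))) r₅.domain → r₇.domain = {v | ∀ i, v i ∈ Set.Ioo (0:ℝ) 1} → Set.EqOn r₇.integrand (fun v => v 0 * (1 - v 0) * ∏ i : Fin 10, 1 / Real.sqrt (v i.succ * (1 - v i.succ) * (1 - (if (i : ℕ) < 4 then v 0 else 1 - v 0) * v i.succ))) r₇.domain → Literature.NumberTheory.Transcendental.KZ.of c + (36 : ℤ) • Literature.NumberTheory.Transcendental.KZ.of r₃ - (224 : ℤ) • Literature.NumberTheory.Transcendental.KZ.of r₅ + (64 : ℤ) • Literature.NumberTheory.Transcendental.KZ.of r₇ ∈ Literature.NumberTheory.Transcendental.KZ.relations := by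
  sorry

/-- STUB (provable now): the eigen-equation as integrand additivity on the pattern-6 family:
`24[R₅] + [u] + [w] − [c] ∈ relations`. [cite: KontsevichZagier2001, §1.2 rule (1)] -/
theorem stub_eigenIdentity :
    ∀ (r₅ u w c : Literature.NumberTheory.Transcendental.KZ.IntegralRep 11), r₅.domain = {v | ∀ i, v i ∈ Set.Ioo (0:ℝ) 1} → Set.EqOn r₅.integrand (fun v => v 0 * (1 - v 0) * ∏ i : Fin 10, 1 / Real.sqrt (v i.succ * (1 - v i.succ) * (1 - (if (i : ℕ) < 6 then v 0 else 1 - v 0) * v i.succ))) r₅.domain → u.domain = {v | ∀ i, v i ∈ Set.Ioo (0:ℝ) 1} → Set.EqOn u.integrand (fun v => 8 * v 0 ^ 3 * ∏ i : Fin 10, 1 / Real.sqrt (v i.succ * (1 - v i.succ) * (1 - (if (i : ℕ) < 6 then v 0 else 1 - v 0) * v i.succ))) u.domain → w.domain = {v | ∀ i, v i ∈ Set.Ioo (0:ℝ) 1} → Set.EqOn w.integrand (fun v => 8 * (1 - v 0) ^ 3 * ∏ i : Fin 10, 1 / Real.sqrt (v i.succ * (1 - v i.succ) * (1 - (if (i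 : ℕ) < 6 then v 0 else 1 - v 0) * v i.succ))) w.domain → c.domain = {v | ∀ i, v i ∈ Set.Ioo (0:ℝ) 1} → Set.EqOn c.integrand (fun v => (8 : ℝ) * ∏ i : Fin 10, 1 / Real.sqrt (v i.succ * (1 - v i.succ) * (1 - (if (i : ℕ) < 6 then v 0 else 1 - v 0) * v i.succ))) c.domain → (24 : ℤ) • Literature.NumberTheory.Transcendental.KZ.of r₅ + Literature.NumberTheory.Transcendental.KZ.of u + Literature.NumberTheory.Transcendental.KZ.of w - Literature.NumberTheory.Transcendental.KZ.of c ∈ Literature.NumberTheory.Transcendental.KZ.relations := by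
  sorry

/-- STUB (provable now): the three auxiliary representations exist. [cite: KontsevichZagier2001, §1.1] -/
theorem stub_auxRepsExist :
    ∃ (u w c : Literature.NumberTheory.Transcendental.KZ.IntegralRep 11), (u.domain = {v | ∀ i, v i ∈ Set.Ioo (0:ℝ) 1} ∧ Set.EqOn u.integrand (fun v => 8 * v 0 ^ 3 * ∏ i : Fin 10, 1 / Real.sqrt (v i.succ * (1 - v i.succ) * (1 - (if (i : ℕ) < 6 then v 0 else 1 - v 0) * v i.succ))) u.domain) ∧ (w.domain = {v | ∀ i, v i ∈ Set.Ioo (0:ℝ) 1} ∧ Set.EqOn w.integrand (fun v => 8 * (1 - v 0) ^ 3 * ∏ i : Fin 10, 1 / Real.sqrt (v i.succ * (1 - v i.succ) * (1 - (if (i : ℕ) < 6 then v 0 else 1 - v 0) * v i.succ))) w.domain) ∧ (c.domain = {v | ∀ i, v i ∈ Set.Ioo (0:ℝ) 1} ∧ Set.EqOn c.integrand (fun v => (8 : ℝ) * ∏ i : Fin 10, 1 / Real.sqrt (v i.succ * (1 - v i.succ) * (1 - (if (i : ℕ) < 6 then v 0 else 1 - v 0) * v i.succ))) c.domain) := by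
  sorry

/-- **Composition (real proof): the five stubs give the piece `LegendreMiddleTrace`** —
`ρ_cusp + ρ_eigen − ρ_desc − ρ_asc = 4·(9[R₃] − 30[R₅] + 16[R₇])`, then division by `4`. [cite: Manin1973, §§7–9] -/
theorem LegendreMiddleTrace_of
    (hA : ∀ (r₅ u : Literature.NumberTheory.Transcendental.KZ.IntegralRep 11), r₅.domain = {v | ∀ i, v i ∈ Set.Ioo (0:ℝ) 1} → Set.EqOn r₅.integrand (fun v => v 0 * (1 - v 0) * ∏ i : Fin 10, 1 / Real.sqrt (v i.succ * (1 - v i.succ) * (1 - (if (i : ℕ) < 6 then v 0 else 1 - v 0) * v i.succ))) r₅.domain → u.domain = {v | ∀ i, v i ∈ Set.Ioo (0:ℝ) 1} → Set.EqOn u.integrand (fun v => 8 * v 0 ^ 3 * ∏ i : Fin 10, 1 / Real.sqrt (v i.succ * (1 - v i.succ) * (1 - (if (i : ℕ) < 6 then v 0 else 1 - v 0) * v i.succ))) u.domain → Literature.NumberTheory.Transcendental.KZ.of u - (64 : ℤ) • Literature.NumberTheory.Transcendental.KZ.of r₅ ∈ Literature.NumberTheory.Transcendental.KZ.relations)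
    (hB : ∀ (r₅ w : Literature.NumberTheory.Transcendental.KZ.IntegralRep 11), r₅.domain = {v | ∀ i, v i ∈ Set.Ioo (0:ℝ) 1} → Set.EqOn r₅.integrand (fun v => v 0 * (1 - v 0) * ∏ i : Fin 10, 1 / Real.sqrt (v i.succ * (1 - v i.succ) * (1 - (if (i : ℕ) < 6 then v 0 else 1 - v 0) * v i.succ))) r₅.domain → w.domain = {v | ∀ i, v i ∈ Set.Ioo (0:ℝ) 1} → Set.EqOn w.integrand (fun v => 8 * (1 - v 0) ^ 3 * ∏ i : Fin 10, 1 / Real.sqrt (v i.succ * (1 - v i.succ) * (1 - (if (i : ℕ) < 6 then v 0 else 1 - v 0) * v i.succ))) w.domain → Literature.NumberTheory.Transcendental.KZ.of w - (16 : ℤ) • Literature.NumberTheory.Transcendental.KZ.of r₅ ∈ Literature.NumberTheory.Transcendental.KZ.relations)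
    (hC : ∀ (c r₃ r₅ r₇ : Literature.NumberTheory.Transcendental.KZ.IntegralRep 11), c.domain = {v | ∀ i, v i ∈ Set.Ioo (0:ℝ) 1} → Set.EqOn c.integrand (fun v => (8 : ℝ) * ∏ i : Fin 10, 1 / Real.sqrt (v i.succ * (1 - v i.succ) * (1 - (if (i : ℕ) < 6 then v 0 else 1 - v 0) * v i.succ))) c.domain → r₃.domain = {v | ∀ i, v i ∈ Set.Ioo (0:ℝ) 1} → Set.EqOn r₃.integrand (fun v => v 0 * (1 - v 0) * ∏ i : Fin 10, 1 / Real.sqrt (v i.succ * (1 - v i.succ) * (1 - (if (i : ℕ) < 8 then v 0 else 1 - v 0) * v i.succ))) r₃.domain → r₅.domain = {v | ∀ i, v i ∈ Set.Ioo (0:ℝ) 1} → Set.EqOn r₅.integrand (fun v => v 0 * (1 - v 0) * ∏ i : Fin 10, 1 / Real.sqrt (v i.succ * (1 - v i.succ) * (1 - (if (i : ℕ) < 6 then v 0 else 1 - v 0) * v i.succ))) r₅.domain → r₇.domain = {v | ∀ i, v i ∈ Set.Ioo (0:ℝ) 1} → Set.EqOn r₇.integrand (fun v => v 0 * (1 -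 v 0) * ∏ i : Fin 10, 1 / Real.sqrt (v i.succ * (1 - v i.succ) * (1 - (if (i : ℕ) < 4 then v 0 else 1 - v 0) * v i.succ))) r₇.domain → Literature.NumberTheory.Transcendental.KZ.of c + (36 : ℤ) • Literature.NumberTheory.Transcendental.KZ.of r₃ - (224 : ℤ) • Literature.NumberTheory.Transcendental.KZ.of r₅ + (64 : ℤ) • Literature.NumberTheory.Transcendental.KZ.of r₇ ∈ Literature.NumberTheory.Transcendental.KZ.relations)
    (hE : ∀ (r₅ u w c : Literature.NumberTheory.Transcendental.KZ.IntegralRep 11), r₅.domain = {v | ∀ i, v i ∈ Set.Ioo (0:ℝ) 1} → Set.EqOn r₅.integrand (fun v => v 0 * (1 - v 0) * ∏ i : Fin 10, 1 / Real.sqrt (v i.succ * (1 - v i.succ) * (1 - (if (i : ℕ) < 6 then v 0 else 1 - v 0) * v i.succ))) r₅.domain → u.domain = {v | ∀ i, v i ∈ Set.Ioo (0:ℝ) 1} → Set.EqOn u.integrand (fun v => 8 * v 0 ^ 3 * ∏ i : Fin 10, 1 / Real.sqrt (v i.succ * (1 - v i.succ) * (1 - (if (i : ℕ) < 6 then v 0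 else 1 - v 0) * v i.succ))) u.domain → w.domain = {v | ∀ i, v i ∈ Set.Ioo (0:ℝ) 1} → Set.EqOn w.integrand (fun v => 8 * (1 - v 0) ^ 3 * ∏ i : Fin 10, 1 / Real.sqrt (v i.succ * (1 - v i.succ) * (1 - (if (i : ℕ) < 6 then v 0 else 1 - v 0) * v i.succ))) w.domain → c.domain = {v | ∀ i, v i ∈ Set.Ioo (0:ℝ) 1} → Set.EqOn c.integrand (fun v => (8 : ℝ) * ∏ i : Fin 10, 1 / Real.sqrt (v i.succ * (1 - v i.succ) * (1 - (if (i : ℕ) < 6 then v 0 else 1 - v 0) * v i.succ))) c.domain → (24 : ℤ) • Literature.NumberTheory.Transcendental.KZ.of r₅ + Literature.NumberTheory.Transcendental.KZ.of u + Literature.NumberTheory.Transcendental.KZ.of w - Literature.NumberTheory.Transcendental.KZ.of c ∈ Literature.NumberTheory.Transcendental.KZ.relations)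
    (hX : ∃ (u w c : Literature.NumberTheory.Transcendental.KZ.IntegralRep 11), (u.domain = {v | ∀ i, v i ∈ Set.Ioo (0:ℝ) 1} ∧ Set.EqOn u.integrand (fun v => 8 * v 0 ^ 3 * ∏ i : Fin 10, 1 / Real.sqrt (v i.succ * (1 - v i.succ) * (1 - (if (i : ℕ) < 6 then v 0 else 1 - v 0) * v i.succ))) u.domain) ∧ (w.domain = {v | ∀ i, v i ∈ Set.Ioo (0:ℝ) 1} ∧ Set.EqOn w.integrand (fun v => 8 * (1 - v 0) ^ 3 * ∏ i : Fin 10, 1 / Real.sqrt (v i.succ * (1 - v i.succ) * (1 - (if (i : ℕ) < 6 then v 0 else 1 - v 0) * v i.succ))) w.domain) ∧ (c.domain = {v | ∀ i, v i ∈ Set.Ioo (0:ℝ) 1} ∧ Set.EqOn c.integrand (fun v => (8 : ℝ) * ∏ i : Fin 10, 1 / Real.sqrt (v i.succ * (1 - v i.succ) * (1 - (if (i : ℕ) < 6 then v 0 else 1 - v 0) * v i.succ))) c.domain)) :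
    ∀ (r₃ r₅ r₇ : Literature.NumberTheory.Transcendental.KZ.IntegralRep 11), r₃.domain = {v | ∀ i, v i ∈ Set.Ioo (0:ℝ) 1} → Set.EqOn r₃.integrand (fun v => v 0 * (1 - v 0) * ∏ i : Fin 10, 1 / Real.sqrt (v i.succ * (1 - v i.succ) * (1 - (if (i : ℕ) < 8 then v 0 else 1 - v 0) * v i.succ))) r₃.domain → r₅.domain = {v | ∀ i, v i ∈ Set.Ioo (0:ℝ) 1} → Set.EqOn r₅.integrand (fun v => v 0 * (1 - v 0) * ∏ i : Fin 10, 1 / Real.sqrt (v i.succ * (1 - v i.succ) * (1 - (if (i : ℕ) < 6 then v 0 else 1 - v 0) * v i.succ))) r₅.domain → r₇.domain = {v | ∀ i, v i ∈ Set.Ioo (0:ℝ) 1} → Set.EqOn r₇.integrand (fun v => v 0 * (1 - v 0) * ∏ i : Fin 10, 1 / Real.sqrt (v i.succ * (1 - v i.succ) * (1 - (if (i : ℕ) < 4 then v 0 else 1 - v 0) * v i.succ))) r₇.domain → (9 : ℤ) • Literature.NumberTheory.Transcendental.KZ.of r₃ - (30 : ℤ) • Literature.NumberTheory.Transcendental.KZ.of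 r₅ + (16 : ℤ) • Literature.NumberTheory.Transcendental.KZ.of r₇ ∈ Literature.NumberTheory.Transcendental.KZ.relations := by
  intro r₃ r₅ r₇ hd₃ he₃ hd₅ he₅ hd₇ he₇
  obtain ⟨u, w, c, ⟨hdu, heu⟩, ⟨hdw, hew⟩, ⟨hdc, hec⟩⟩ := hX
  have ρA := hA r₅ u hd₅ he₅ hdu heu
  have ρB := hB r₅ w hd₅ he₅ hdw hew
  have ρC := hC c r₃ r₅ r₇ hdc hec hd₃ he₃ hd₅ he₅ hd₇ he₇
  have ρE := hE r₅ u w c hd₅ he₅ hdu heu hdw hew hdc hec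
  have key : (4 : ℤ) • ((9 : ℤ) • of r₃ - (30 : ℤ) • of r₅ + (16 : ℤ) • of r₇) =
      (of c + (36 : ℤ) • of r₃ - (224 : ℤ) • of r₅ + (64 : ℤ) • of r₇)
        + ((24 : ℤ) • of r₅ + of u + of w - of c)
        - (of u - (64 : ℤ) • of r₅) - (of w - (16 : ℤ) • of r₅) := by
    module
  have h4 : (4 : ℤ) • ((9 : ℤ) • of r₃ - (30 : ℤ) • of r₅ + (16 : ℤ) • of r₇) ∈ relations := by
    rw [key]
    exact relations.sub_mem (relations.sub_mem (relations.add_mem ρC ρE) ρA) ρB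
  exact mem_relations_of_zsmul_mem (by norm_num) h4

/-- The skeleton closes the piece from the registered stubs. [cite: Manin1973, §§7–9] -/
theorem legendreMiddleTrace_of_stubs : ∀ (r₃ r₅ r₇ : Literature.NumberTheory.Transcendental.KZ.IntegralRep 11), r₃.domain = {v | ∀ i, v i ∈ Set.Ioo (0:ℝ) 1} → Set.EqOn r₃.integrand (fun v => v 0 * (1 - v 0) * ∏ i : Fin 10, 1 / Real.sqrt (v i.succ * (1 - v i.succ) * (1 - (if (i : ℕ) < 8 then v 0 else 1 - v 0) * v i.succ))) r₃.domain → r₅.domain = {v | ∀ i, v i ∈ Set.Ioo (0:ℝ) 1} → Set.EqOn r₅.integrand (fun v => v 0 * (1 - v 0) * ∏ i : Fin 10, 1 / Real.sqrt (v i.succ * (1 - v i.succ) * (1 - (if (i : ℕ) < 6 then v 0 else 1 - v 0) * v i.succ))) r₅.domain → r₇.domain = {v | ∀ i, v i ∈ Set.Ioo (0:ℝ) 1} → Set.EqOn r₇.integrand (fun v => v 0 * (1 - v 0) * ∏ i : Fin 10, 1 / Real.sqrt (v i.succ * (1 - v i.succ) * (1 - (if (i : ℕ) < 4 then v 0 else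 1 - v 0) * v i.succ))) r₇.domain → (9 : ℤ) • Literature.NumberTheory.Transcendental.KZ.of r₃ - (30 : ℤ) • Literature.NumberTheory.Transcendental.KZ.of r₅ + (16 : ℤ) • Literature.NumberTheory.Transcendental.KZ.of r₇ ∈ Literature.NumberTheory.Transcendental.KZ.relations :=
  LegendreMiddleTrace_of stub_landenDescending stub_landenAscending stub_cuspHalf stub_eigenIdentity stub_auxRepsExist

end Summit.KontsevichZagierPeriods.KontsevichZagierPeriods.Cruxes.DeltaRatioHecke.MiddleTraceBirth

end
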